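import Literature.MathematicalPhysics.QuantumFieldTheory.OneCharacterTwistBound
import Literature.MathematicalPhysics.QuantumFieldTheory.TwistedSectorExpansion
import Summits.Ventures.LatticeQCDFlow.Scoring.SU2ClassFunctionConvolution
import HarnessLib

/-!
# Venture YMGap, track (b) — the twisted-sector weights of Tomboulis's App. A §5 for EVERY spin cut-off,
# and the SU(2) character kernels as integral Gram forms

HONEST FRAMING: venture file of the cell `pub-ymgap` (QuantumFields programme), track (b).  Bookkeeping for
the companion file `CharacterTwistBound` (Tomboulis, arXiv:0707.2179, Prop. IV.1 `|Z⁻_Λ| ≤ Z_Λ` for every spin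
cut-off `J` of `TomboulisVortexDecimation`); finite tori only, nothing about (5.15), the thermodynamic limit,
confinement or a mass gap.

Contents (vocabulary of `TomboulisVortexDecimation` / `TwistedSectorExpansion` and of the reflection-positivity
files `ConstructiveQFTWave0Proofs` (`WilsonRP`) / `LatticeRPMechanism`):
* `sectorWeight` — the `Q`-sector weight `w_p = Σ_{n ≤ J} a_{p,n} χ_n(U_p)` of a plaquette in the integrand of
  (A.18) (`f` off the twist set `V`, `S^{1/2}` on `Q`, `S^1` on `V ∖ Q`; coefficients `coefA ≥ 0` when
  `c_j ≥ 0`), `tSector_integrand_eq_prod`; the split `∏_p w_p = G(U) G(ΘU) W_×(U)` into positive, reflected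
  and crossing plaquettes (`prod_sectorWeight_split`).
* **The new ingredient for general `J`**: every character kernel is an INTEGRAL Gram form,
  `χ_n(g h⁻¹) = (n+1) ∫_{SU(2)} χ_n(g R) χ_n(h R) dR` (`charKernel_eq_integral`) — the character convolution
  identity `∫ χ_m(AV) χ_n(V⁻¹B) dV = [m=n] χ_n(AB)/(n+1)` of the venture `LatticeQCDFlow`
  (`Summit.Ventures.LatticeQCDFlow.Scoring.integral_su2Character_mul_conv`, a kernel theorem proved there
  without Peter–Weyl) with `a₀(V⁻¹h⁻¹) = a₀(hV)`.  Hence, after the Osterwalder–Seiler splitting of the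
  crossing links (`WilsonRP.translate`, `plaqRe_translate_of_isCrossPlaq`), the crossing weight is
  `W_×(translate Y U) = Σ_x Γ_x ∫_{R⃗} Ψ_x(z, R⃗) Ψ_x(ΘU, R⃗) dR⃗` with `Γ_x ≥ 0` (`wCrossJ_translate`), and the
  whole `Q`-sector integrand is organised by `PhiX` / `Mint` (positive-side observables `Φ_{x,R⃗}` depending
  on the links in `P ∪ C` only, `dependsOn_PhiX`).
(This file lives under `Summits/` because a Literature module may not import the `LatticeQCDFlow` theorem.)

References: E. T. Tomboulis, arXiv:0707.2179, App. A §5 eqs. (A.17)–(A.18) [cite: Tomboulis2007Confinement,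
App. A §5]; K. Osterwalder, E. Seiler, Ann. Phys. 110 (1978) 440, §2 [cite: OsterwalderSeilerAnnPhys1978, §2].
-/

noncomputable section

open MeasureTheory Finset Real
open scoped BigOperators ComplexConjugate
open Literature.MathematicalPhysics.QuantumLattice
open Literature.MathematicalPhysics.QuantumFieldTheory
open Literature.MathematicalPhysics.QuantumFieldTheory.Tomboulis2007
open Literature.MathematicalPhysics.QuantumFieldTheory.WilsonRP
open Summit.Ventures.LatticeQCDFlow.Exactness
open Summit.Ventures.LatticeQCDFlow.Scoring

namespace Summit.Ventures.YMGap.Census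

variable {d L : ℕ}

/-! ### Characters as functions of `r = Re tr U_p`; the sector weights -/

/-- `χ_j` as a function of `r = Re tr U`: `charR n r = U_n(r/2)` (`n = 2j`, `U_n` the Chebyshev polynomial of the
second kind), so that `su2Char n W = charR n (Re tr W)`. -/
def charR (n : ℕ) (r : ℝ) : ℝ :=
  (Polynomial.Chebyshev.U ℝ (n : ℤ)).eval (r / 2)

/-- `χ_0 = 1`. -/
theorem charR_zero (r : ℝ) : charR 0 r = 1 := by
  simp [charR]

/-- `χ_n(U_p) = charR n (Re tr U_p)` (definitional). -/
theorem su2Char_hol_eq_charR (n : ℕ) (W : GaugeConfig d L SU2) (p : Plaquette d L) :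
    su2Char n (plaquetteHolonomy W p.1 p.2.1.1 p.2.1.2) = charR n (plaqRe rhoFund W p) :=
  rfl

/-- The plaquette function as a function of `r`: `fR J c r = 1 + Σ_{n=1}^{J} (n+1) c_n charR n r`. -/
def fR (J : ℕ) (c : ℕ → ℝ) (r : ℝ) : ℝ :=
  1 + ∑ n ∈ Icc 1 J, ((n : ℝ) + 1) * c n * charR n r

/-- `f(U_p) = fR (Re tr U_p)`. -/
theorem plaqFn_hol_eq_fR (J : ℕ) (c : ℕ → ℝ) (W : GaugeConfig d L SU2) (p : Plaquette d L) :
    plaqFn J c (plaquetteHolonomy W p.1 p.2.1.1 p.2.1.2) = fR J c (plaqRe rhoFund W p) :=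
  rfl

/-- **The character coefficients of the `Q`-sector weight of a plaquette** (arXiv:0707.2179 App. A §5, the
integrand of (A.18)): off the twist set `V` the full plaquette function `f = 1 + Σ_{j≠0} d_j c_j χ_j`; on `Q` the
half-integer part `S^{1/2} = Σ_{j half-integer} d_j c_j χ_j`; on `V ∖ Q` the integer part
`S^1 = 1 + Σ_{j integer ≠ 0} d_j c_j χ_j`.  Indexed by `n = 2j`; the constant term is `n = 0`. -/
def coefA (c : ℕ → ℝ) (V Q : Finset (Plaquette d L)) (p : Plaquette d L) (n : ℕ) : ℝ :=
  if n = 0 then (if p ∈ Q then 0 else 1)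
  else if p ∉ V ∨ (p ∈ Q ∧ Odd n) ∨ (p ∉ Q ∧ Even n) then ((n : ℝ) + 1) * c n else 0

/-- The coefficients are non-negative when `c_j ≥ 0` for `j ≠ 0`. -/
theorem coefA_nonneg {c : ℕ → ℝ} (hc : ∀ n, 1 ≤ n → 0 ≤ c n) (V Q : Finset (Plaquette d L))
    (p : Plaquette d L) (n : ℕ) : 0 ≤ coefA c V Q p n := by
  unfold coefA
  split_ifs with h0
  · exact le_rfl
  · exact zero_le_one
  · exact mul_nonneg (by positivity) (hc n (Nat.one_le_iff_ne_zero.mpr h0))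
  · exact le_rfl

/-- **The `Q`-sector weight of plaquette `p`** as a character sum with spin cut-off `J`:
`w_p(r) = Σ_{n=0}^{J} coefA_p(n) charR n r`. -/
def sectorWeight (J : ℕ) (c : ℕ → ℝ) (V Q : Finset (Plaquette d L)) (p : Plaquette d L) (r : ℝ) : ℝ :=
  ∑ n ∈ Finset.range (J + 1), coefA c V Q p n * charR n r

/-- `Σ_{n=0}^{J} g(n) = g(0) + Σ_{n=1}^{J} g(n)` (plumbing). -/
theorem sum_range_succ_eq_add_sum_Icc (J : ℕ) (g : ℕ → ℝ) :
    ∑ n ∈ Finset.range (J + 1), g n = g 0 + ∑ n ∈ Icc 1 J, g n := by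
  induction J with
  | zero => simp
  | succ J ih =>
    rw [Finset.sum_range_succ, ih, Finset.sum_Icc_succ_top (by omega : 1 ≤ J + 1)]
    ring

/-- Off the twist set the sector weight is the full plaquette function. -/
theorem sectorWeight_of_not_mem (J : ℕ) (c : ℕ → ℝ) {V Q : Finset (Plaquette d L)} (hQ : Q ⊆ V)
    {p : Plaquette d L} (hp : p ∉ V) (r : ℝ) : sectorWeight J c V Q p r = fR J c r := by
  have hpQ : p ∉ Q := fun h => hp (hQ h)
  unfold sectorWeight fR
  rw [sum_range_succ_eq_add_sum_Icc]
  congr 1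
  · simp [coefA, hpQ, charR_zero]
  · refine Finset.sum_congr rfl fun n hn => ?_
    have hn0 : n ≠ 0 := by have := (Finset.mem_Icc.1 hn).1; omega
    simp [coefA, hn0, hp]

/-- On `Q` the sector weight is `S^{1/2}`. -/
theorem sectorWeight_of_mem (J : ℕ) (c : ℕ → ℝ) {V Q : Finset (Plaquette d L)} (hQ : Q ⊆ V)
    {p : Plaquette d L} (hp : p ∈ Q) (W : SU2) :
    sectorWeight J c V Q p (((W : Matrix (Fin 2) (Fin 2) ℂ).trace).re) = sHalf J c W := by
  have hpV : p ∈ V := hQ hp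
  unfold sectorWeight sHalf
  rw [sum_range_succ_eq_add_sum_Icc, Finset.sum_filter]
  have h0 : coefA c V Q p 0 * charR 0 (((W : Matrix (Fin 2) (Fin 2) ℂ).trace).re) = 0 := by
    simp [coefA, hp]
  rw [h0, zero_add]
  refine Finset.sum_congr rfl fun n hn => ?_
  have hn0 : n ≠ 0 := by have := (Finset.mem_Icc.1 hn).1; omega
  by_cases hodd : Odd n
  · rw [if_pos hodd]
    simp only [coefA, hn0, ↓reduceIte, hpV, not_true_eq_false, hp, hodd, and_self, true_or, or_true]
    rfl
  · rw [if_neg hodd]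
    have hne : ¬ (p ∉ V ∨ (p ∈ Q ∧ Odd n) ∨ (p ∉ Q ∧ Even n)) := by
      push Not
      exact ⟨hpV, fun _ => hodd, fun h => absurd hp h⟩
    simp only [coefA, hn0, ↓reduceIte, hne, zero_mul]

/-- On `V ∖ Q` the sector weight is `S^1`. -/
theorem sectorWeight_of_mem_sdiff (J : ℕ) (c : ℕ → ℝ) {V Q : Finset (Plaquette d L)}
    {p : Plaquette d L} (hpV : p ∈ V) (hpQ : p ∉ Q) (W : SU2) :
    sectorWeight J c V Q p (((W : Matrix (Fin 2) (Fin 2) ℂ).trace).re) = sInt J c W := by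
  unfold sectorWeight sInt
  rw [sum_range_succ_eq_add_sum_Icc, Finset.sum_filter]
  congr 1
  · simp [coefA, hpQ, charR_zero]
  · refine Finset.sum_congr rfl fun n hn => ?_
    have hn0 : n ≠ 0 := by have := (Finset.mem_Icc.1 hn).1; omega
    by_cases hev : Even n
    · rw [if_pos hev]
      have hyes : (p ∉ V ∨ (p ∈ Q ∧ Odd n) ∨ (p ∉ Q ∧ Even n)) := Or.inr (Or.inr ⟨hpQ, hev⟩)
      simp only [coefA, hn0, ↓reduceIte, hyes]
      rfl
    · rw [if_neg hev]
      have hne : ¬ (p ∉ V ∨ (p ∈ Q ∧ Odd n) ∨ (p ∉ Q ∧ Even n)) := by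
        push Not
        exact ⟨hpV, fun h => absurd h hpQ, fun _ => hev⟩
      simp only [coefA, hn0, ↓reduceIte, hne, zero_mul]

/-- **The `Q`-sector integrand of (A.18) as a product of sector weights over ALL plaquettes.** -/
theorem tSector_integrand_eq_prod [NeZero L] (J : ℕ) (c : ℕ → ℝ) {V Q : Finset (Plaquette d L)} (hQ : Q ⊆ V)
    (W : GaugeConfig d L SU2) :
    (∏ p ∈ Vᶜ, plaqFn J c (plaquetteHolonomy W p.1 p.2.1.1 p.2.1.2)) *
        ((∏ p ∈ Q, sHalf J c (plaquetteHolonomy W p.1 p.2.1.1 p.2.1.2)) *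
          ∏ p ∈ V \ Q, sInt J c (plaquetteHolonomy W p.1 p.2.1.1 p.2.1.2)) =
      ∏ p : Plaquette d L, sectorWeight J c V Q p (plaqRe rhoFund W p) := by
  rw [← Finset.prod_mul_prod_compl V (fun p => sectorWeight J c V Q p (plaqRe rhoFund W p)),
    ← Finset.prod_sdiff hQ, mul_comm]
  have h1 : ∏ p ∈ V \ Q, sectorWeight J c V Q p (plaqRe rhoFund W p) =
      ∏ p ∈ V \ Q, sInt J c (plaquetteHolonomy W p.1 p.2.1.1 p.2.1.2) :=
    Finset.prod_congr rfl fun p hp => by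
      obtain ⟨hpV, hpQ⟩ := Finset.mem_sdiff.mp hp
      exact sectorWeight_of_mem_sdiff J c hpV hpQ _
  have h2 : ∏ p ∈ Q, sectorWeight J c V Q p (plaqRe rhoFund W p) =
      ∏ p ∈ Q, sHalf J c (plaquetteHolonomy W p.1 p.2.1.1 p.2.1.2) :=
    Finset.prod_congr rfl fun p hp => sectorWeight_of_mem J c hQ hp _
  have h3 : ∏ p ∈ Vᶜ, sectorWeight J c V Q p (plaqRe rhoFund W p) =
      ∏ p ∈ Vᶜ, plaqFn J c (plaquetteHolonomy W p.1 p.2.1.1 p.2.1.2) :=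
    Finset.prod_congr rfl fun p hp => by
      rw [sectorWeight_of_not_mem J c hQ (Finset.mem_compl.mp hp), plaqFn_hol_eq_fR]
  rw [h1, h2, h3]
  ring


section RP

variable [NeZero d] [NeZero L] [Fact (1 < L)]

/-! ### Splitting into positive, reflected-positive and crossing plaquettes -/

/-- The positive-time part of the weight, `G(W) = ∏_{p positive} f(U_p)`. -/
def gPosJ (J : ℕ) (c : ℕ → ℝ) (W : GaugeConfig d L SU2) : ℝ :=
  ∏ p ∈ univ.filter IsPosPlaq, fR J c (plaqRe rhoFund W p)

/-- The crossing part of the `Q`-sector weight, `W_×(W) = ∏_{p crossing} w_p(U_p)`. -/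
def wCrossJ (J : ℕ) (c : ℕ → ℝ) (V Q : Finset (Plaquette d L)) (W : GaugeConfig d L SU2) : ℝ :=
  ∏ p ∈ univ.filter IsCrossPlaq, sectorWeight J c V Q p (plaqRe rhoFund W p)

/-- The negative plaquettes are the reflected positive ones: `∏_{p neg} φ(Re tr U_p) =
∏_{p pos} φ(Re tr (ΘU)_p)` (as in `OneCharacterTwistBound`; `plaqRe_timeReflect`, `plaqReflectEquiv`). -/
theorem prod_neg_eq_prod_pos_timeReflect (hL : Even L) (φ : ℝ → ℝ) (W : GaugeConfig d L SU2) :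
    ∏ p ∈ univ.filter IsNegPlaq, φ (plaqRe rhoFund W p) =
      ∏ p ∈ univ.filter IsPosPlaq, φ (plaqRe rhoFund W.timeReflect p) := by
  simp_rw [plaqRe_timeReflect rhoFund (continuous_fundamentalRep (Fin 2))]
  symm
  refine Finset.prod_equiv plaqReflectEquiv (fun p => ?_) (fun p _ => rfl)
  simp only [Finset.mem_filter, Finset.mem_univ, true_and]
  exact (isNegPlaq_plaqReflect_iff hL p).symm

/-- **`∏_p w_p(U) = G(U) · G(ΘU) · W_×(U)`** when the twist set consists of crossing plaquettes. -/
theorem prod_sectorWeight_split (hL : Even L) (J : ℕ) (c : ℕ → ℝ) {V Q : Finset (Plaquette d L)}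
    (hV : ∀ p ∈ V, IsCrossPlaq p) (hQ : Q ⊆ V) (W : GaugeConfig d L SU2) :
    ∏ p : Plaquette d L, sectorWeight J c V Q p (plaqRe rhoFund W p) =
      gPosJ J c W * gPosJ J c W.timeReflect * wCrossJ J c V Q W := by
  rw [← Finset.prod_filter_mul_prod_filter_not univ IsCrossPlaq, mul_comm]
  unfold wCrossJ gPosJ
  congr 1
  have hw : ∀ p ∈ univ.filter (fun p => ¬ IsCrossPlaq p),
      sectorWeight J c V Q p (plaqRe rhoFund W p) = fR J c (plaqRe rhoFund W p) := by
    intro p hp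
    have hpV : p ∉ V := fun h => (Finset.mem_filter.mp hp).2 (hV p h)
    exact sectorWeight_of_not_mem J c hQ hpV _
  rw [Finset.prod_congr rfl hw,
    ← Finset.prod_filter_mul_prod_filter_not (univ.filter fun p => ¬ IsCrossPlaq p) IsPosPlaq,
    Finset.filter_filter, Finset.filter_filter]
  have hpos : univ.filter (fun p : Plaquette d L => ¬ IsCrossPlaq p ∧ IsPosPlaq p) = univ.filter IsPosPlaq :=
    Finset.filter_congr fun p _ =>
      ⟨fun h => h.2, fun h => ⟨fun hc => not_isPosPlaq_of_isCrossPlaq hL hc h, h⟩⟩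
  have hneg : univ.filter (fun p : Plaquette d L => ¬ IsCrossPlaq p ∧ ¬ IsPosPlaq p) =
      univ.filter IsNegPlaq :=
    Finset.filter_congr fun p _ => ⟨fun h => ⟨h.2, h.1⟩, fun h => ⟨h.2, h.1⟩⟩
  have h4 := prod_neg_eq_prod_pos_timeReflect hL (fR J c) W
  rw [hpos, hneg, h4]

/-! ### The character kernels as integral Gram forms (the new ingredient)

For a crossing plaquette `p`, after the substitution `translate Y`, `Re tr U_p = Re tr (ω_p(z) ω_p(ΘU)⁻¹)`
(`WilsonRP.plaqRe_translate_of_isCrossPlaq` with the unitarian-trick sum folded back by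
`re_trace_mul_inv_eq_sum`), so `χ_n(U_p) = U_n(a₀(g h⁻¹))` with `g = ω_p(z)`, `h = ω_p(ΘU)`,
`a₀ = Re tr/2`; and by the character convolution identity of `LatticeQCDFlow`
(`integral_su2Character_mul_conv`) together with `a₀(V⁻¹ h⁻¹) = a₀(h V)`,
`U_n(a₀(g h⁻¹)) = (n+1) ∫ U_n(a₀(g R)) U_n(a₀(h R)) dR`. -/

/-- The Gram weights: `coefA_p(n) · (n+1)` on crossing plaquettes, the trivial weight `[n = 0]` elsewhere. -/
def gWt (c : ℕ → ℝ) (V Q : Finset (Plaquette d L)) (p : Plaquette d L) (n : ℕ) : ℝ :=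
  if IsCrossPlaq p then coefA c V Q p n * ((n : ℝ) + 1) else (if n = 0 then 1 else 0)

omit [NeZero L] [Fact (1 < L)] in
/-- The Gram weights are non-negative when `c_j ≥ 0`, `j ≠ 0`. -/
theorem gWt_nonneg {c : ℕ → ℝ} (hc : ∀ n, 1 ≤ n → 0 ≤ c n) (V Q : Finset (Plaquette d L))
    (p : Plaquette d L) (n : ℕ) : 0 ≤ gWt c V Q p n := by
  unfold gWt
  split_ifs
  · exact mul_nonneg (coefA_nonneg hc V Q p n) (by positivity)
  · exact zero_le_one
  · exact le_rfl

/-- The features: `χ_n(ω_p(W) R)` for a crossing plaquette (`ω_p` the half plaquette `WilsonRP.halfPlaq`,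
`R ∈ SU(2)` the auxiliary convolution variable), the constant `1` elsewhere. -/
def feat (p : Plaquette d L) (n : ℕ) (R : SU2) (W : GaugeConfig d L SU2) : ℝ :=
  if IsCrossPlaq p then (Polynomial.Chebyshev.U ℝ (n : ℤ)).eval (su2a0 (halfPlaq p W * R)) else 1

/-- **The crossing identity for `Re tr`**: `Re tr (translate Y U)_p = 2 a₀(ω_p(z) ω_p(ΘU)⁻¹)`. -/
theorem plaqRe_translate_eq_two_mul_su2a0 (hL : Even L) (W Y : GaugeConfig d L SU2) {p : Plaquette d L}
    (hp : IsCrossPlaq p) :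
    plaqRe rhoFund (translate Y W) p =
      2 * su2a0 (halfPlaq p (LatticeRP.splice crossEdges (W, Y)) * (halfPlaq p W.timeReflect)⁻¹) := by
  rw [plaqRe_translate_of_isCrossPlaq rhoFund hL (continuous_fundamentalRep (Fin 2)) W Y hp,
    ← Literature.RepresentationTheory.CompactGroups.CompactGroup.re_trace_mul_inv_eq_sum rhoFund
      (continuous_fundamentalRep (Fin 2))]
  simp only [su2a0, fundamentalRep_apply]
  ring

omit [NeZero d] [NeZero L] [Fact (1 < L)] in
/-- **The character kernel as an integral Gram form**: `χ_n(g h⁻¹) = (n+1) ∫ χ_n(g R) χ_n(h R) dR`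
(`integral_su2Character_mul_conv` of `LatticeQCDFlow` and `a₀(V⁻¹ h⁻¹) = a₀(h V)`). -/
theorem charKernel_eq_integral (n : ℕ) (g h : SU2) :
    (Polynomial.Chebyshev.U ℝ (n : ℤ)).eval (su2a0 (g * h⁻¹)) =
      ((n : ℝ) + 1) * ∫ R, (Polynomial.Chebyshev.U ℝ (n : ℤ)).eval (su2a0 (g * R)) *
        (Polynomial.Chebyshev.U ℝ (n : ℤ)).eval (su2a0 (h * R)) ∂(haarProbability SU2) := by
  have key := integral_su2Character_mul_conv g h⁻¹ n n
  rw [if_pos rfl] at key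
  have hfun : (fun V : SU2 => (Polynomial.Chebyshev.U ℝ (n : ℤ)).eval (su2a0 (g * V)) *
      (Polynomial.Chebyshev.U ℝ (n : ℤ)).eval (su2a0 (V⁻¹ * h⁻¹))) =
      fun R => (Polynomial.Chebyshev.U ℝ (n : ℤ)).eval (su2a0 (g * R)) *
        (Polynomial.Chebyshev.U ℝ (n : ℤ)).eval (su2a0 (h * R)) := by
    funext R
    rw [← mul_inv_rev, su2a0_inv]
  rw [hfun] at key
  rw [key]
  field_simp

/-- **The Gram identity for one plaquette**: after `translate Y`, the factor of a crossing plaquette is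
`Σ_n gWt_p(n) ∫ feat_{p,n}(R, z) feat_{p,n}(R, ΘU) dR`, and the trivial factor `1` of a non-crossing
plaquette has the same form. -/
theorem cross_factor (hL : Even L) (J : ℕ) (c : ℕ → ℝ) (V Q : Finset (Plaquette d L))
    (W Y : GaugeConfig d L SU2) (p : Plaquette d L) :
    (if IsCrossPlaq p then sectorWeight J c V Q p (plaqRe rhoFund (translate Y W) p) else 1) =
      ∑ n ∈ Finset.range (J + 1), gWt c V Q p n *
        ∫ R, feat p n R (LatticeRP.splice crossEdges (W, Y)) * feat p n R W.timeReflect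
          ∂(haarProbability SU2) := by
  by_cases hp : IsCrossPlaq p
  · rw [if_pos hp]
    unfold sectorWeight
    refine Finset.sum_congr rfl fun n _ => ?_
    have hr : charR n (plaqRe rhoFund (translate Y W) p) =
        (Polynomial.Chebyshev.U ℝ (n : ℤ)).eval
          (su2a0 (halfPlaq p (LatticeRP.splice crossEdges (W, Y)) * (halfPlaq p W.timeReflect)⁻¹)) := by
      rw [charR, plaqRe_translate_eq_two_mul_su2a0 hL W Y hp, mul_div_cancel_left₀ _ two_ne_zero]
    simp only [gWt, feat, if_pos hp]
    rw [hr, charKernel_eq_integral]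
    ring
  · rw [if_neg hp]
    simp [gWt, feat, hp]

/-- **The crossing weight after `translate Y` as a sum of integral Gram products over all spin choices
`x : plaquettes → {0, …, J}`**: `W_×(translate Y U) = Σ_x Γ_x ∫_{R⃗} Ψ_x(z, R⃗) Ψ_x(ΘU, R⃗) dR⃗`. -/
theorem wCrossJ_translate (hL : Even L) (J : ℕ) (c : ℕ → ℝ) (V Q : Finset (Plaquette d L))
    (W Y : GaugeConfig d L SU2) :
    wCrossJ J c V Q (translate Y W) =
      ∑ x ∈ Fintype.piFinset (fun _ : Plaquette d L => Finset.range (J + 1)),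
        (∏ p, gWt c V Q p (x p)) *
          ∫ Rv, (∏ p, feat p (x p) (Rv p) (LatticeRP.splice crossEdges (W, Y))) *
            (∏ p, feat p (x p) (Rv p) W.timeReflect)
            ∂(Measure.pi fun _ : Plaquette d L => haarProbability SU2) := by
  unfold wCrossJ
  rw [Finset.prod_filter]
  rw [Finset.prod_congr rfl fun p _ => cross_factor hL J c V Q W Y p, Finset.prod_univ_sum]
  refine Finset.sum_congr rfl fun x _ => ?_
  rw [Finset.prod_mul_distrib]
  congr 1
  rw [← integral_fintype_prod_eq_prod
    (fun p R => feat p (x p) R (LatticeRP.splice crossEdges (W, Y)) * feat p (x p) R W.timeReflect)]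
  refine integral_congr_ae (ae_of_all _ fun Rv => ?_)
  simp only [Finset.prod_mul_distrib]

/-! ### The translated `Q`-sector integrand as an integral over the auxiliary variables -/

/-- `Φ_{x,R⃗}(W) = G(W) ∏_p feat_{p, x_p}(R⃗_p, W)`. -/
def PhiX (J : ℕ) (c : ℕ → ℝ) (x : Plaquette d L → ℕ) (Rv : Plaquette d L → SU2)
    (W : GaugeConfig d L SU2) : ℝ :=
  gPosJ J c W * ∏ p, feat p (x p) (Rv p) W

/-- The tripled integrand `M((U, Y), R⃗) = Σ_x Γ_x Φ_{x,R⃗}(splice_C(U, Y)) Φ_{x,R⃗}(ΘU)`. -/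
def Mint (J : ℕ) (c : ℕ → ℝ) (V Q : Finset (Plaquette d L))
    (q : GaugeConfig d L SU2 × GaugeConfig d L SU2) (Rv : Plaquette d L → SU2) : ℝ :=
  ∑ x ∈ Fintype.piFinset (fun _ : Plaquette d L => Finset.range (J + 1)),
    (∏ p, gWt c V Q p (x p)) *
      (PhiX J c x Rv (LatticeRP.splice crossEdges q) * PhiX J c x Rv (GaugeConfig.timeReflect q.1))

/-- `G` depends only on the positive links. -/
theorem gPosJ_congr (J : ℕ) (c : ℕ → ℝ) {A B : GaugeConfig d L SU2}
    (hAB : ∀ e ∈ ((posEdges : Finset (Edge d L)) : Set (Edge d L)), A e = B e) :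
    gPosJ J c A = gPosJ J c B := by
  unfold gPosJ
  refine Finset.prod_congr rfl fun p hp => ?_
  have hpos : IsPosPlaq p := (Finset.mem_filter.mp hp).2
  obtain ⟨h1, h2, h3, h4⟩ := isPosEdge_of_isPosPlaq hpos
  have h : ∀ e, IsPosEdge e → A e = B e := fun e he => hAB e (by simpa using he)
  simp only [plaqRe, plaquetteHolonomy, h _ h1, h _ h2, h _ h3, h _ h4]

/-- The features depend only on the links in `P ∪ C`. -/
theorem feat_congr (hL : Even L) (p : Plaquette d L) (n : ℕ) (R : SU2) {A B : GaugeConfig d L SU2}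
    (hAB : ∀ e ∈ ((posEdges ∪ crossEdges : Finset (Edge d L)) : Set (Edge d L)), A e = B e) :
    feat p n R A = feat p n R B := by
  unfold feat
  split_ifs with hp
  · rw [halfPlaq_congr hL hp hAB]
  · rfl

/-- `Φ_{x,R⃗}` depends only on the links in `P ∪ C`. -/
theorem dependsOn_PhiX (hL : Even L) (J : ℕ) (c : ℕ → ℝ) (x : Plaquette d L → ℕ)
    (Rv : Plaquette d L → SU2) :
    DependsOn (PhiX J c x Rv) ((posEdges ∪ crossEdges : Finset (Edge d L)) : Set (Edge d L)) := by
  intro A B hAB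
  have hP : ∀ e ∈ ((posEdges : Finset (Edge d L)) : Set (Edge d L)), A e = B e := fun e he =>
    hAB e (by rw [Finset.coe_union]; exact Or.inl he)
  unfold PhiX
  rw [gPosJ_congr J c hP, Finset.prod_congr rfl fun p _ => feat_congr hL p (x p) (Rv p) hAB]

end RP

end Summit.Ventures.YMGap.Census

end
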